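import Mathlib
import Literature.Analysis.Complex.EntireInjectiveAffine
import Literature.Probability.RandomPlanarGeometry.LatticeSimilarityCovariance
import Literature.Probability.RandomPlanarGeometry.SLESixModulusInvariance
import Literature.Probability.RandomPlanarGeometry.ModulusPreservingHolomorphic

/-!
# Crux `CardyRotToConfR2SymmetryUpgrade`, line `isotropy-kills-beltrami`: stub S4a

`stub_slePreservingIsMoebius` for crux stmt-CriticalPhenomena-0698 (registered statement verbatim):
**a homeomorphism `T` of the plane which pushes the chordal SLE₆ law of every Dobrushin domain `D`
to the chordal SLE₆ law of `T D` is an orientation-preserving similarity `z ↦ c z + w` or an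
orientation-reversing one `z ↦ c z̄ + w`** ("SLE₆-family-preserving homeomorphisms are Möbius",
the analytic heart of "isotropy kills Beltrami").

Proof (all inputs are theorems of `Literature/`, landed for this stub):
* (R1, `Literature/Probability/RandomPlanarGeometry/SLESixModulusInvariance`) Cardy's formula
  for SLE₆ (`sle_six_measureReal_hitsBefore_holds`), transport of the crossing event under `T`
  and injectivity of Cardy's function make `T` preserve the conformal modulus (Cardy's cross-ratio, computed from any conformal chart) of every conformal
  rectangle (`crossRatio_eq_of_sle`).
* (R2, `…/JordanBoundaryChart`, `…/ModulusPreservingBoundaryMap`) For every Jordan domain `Ω`,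
  boundary charts of `Ω` and `T Ω` (Riemann mapping + Carathéodory, from the tree) have boundary correspondences with equal
  cross-ratios on all increasing 4-tuples; letting the fourth point tend to the base point gives
  an AFFINE relation, whence an (anti)conformal `G_Ω : Ω → T Ω` with boundary values `T`.
* (R2', `…/JordanArcUniqueness`, `…/TranslatedRectangleDomains`, `…/ModulusPreservingHolomorphic`)
  On a square `B`, `T = G_B`: compare `G_B` with
  `G_H` for the sub-rectangles `H` through each point, via boundary uniqueness on an arc
  (`Complex.eqOn_zero_of_diffContOnCl_ball_of_eqOn_arc`) and a reflection to exclude the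
  anti-conformal composite. So `T` or `conj ∘ T` is holomorphic on every square, hence entire.
* (R2'', `Literature.Analysis.Complex.EntireInjectiveAffine`) A holomorphic homeomorphism of `ℂ`
  is `z ↦ a z + b` (pole at infinity + Liouville); an anti-holomorphic one is `z ↦ a z̄ + b`.
-/

noncomputable section

namespace Summit.CriticalPhenomena.CardyFormulaZ2.Theorems.CardyRotToConfR2SymmetryUpgrade.IsotropyKillsBeltrami

open MeasureTheory Set Filter Topology
open Literature.Probability.RandomPlanarGeometry
open scoped ENNReal ComplexConjugate

/-- Every point lies in the square `(-(m+1), m+1)²` as soon as `⌈‖z‖⌉ ≤ m`. -/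
theorem mem_symRect_of_ceil_le (z : ℂ) {m : ℕ} (hm : ⌈‖z‖⌉₊ ≤ m) :
    z ∈ symRect ((m : ℝ) + 1) ((m : ℝ) + 1) := by
  have h1 : ‖z‖ ≤ m := (Nat.le_ceil ‖z‖).trans (by exact_mod_cast hm)
  have hre := (abs_le.1 ((Complex.abs_re_le_norm z).trans h1))
  have him := (abs_le.1 ((Complex.abs_im_le_norm z).trans h1))
  rw [mem_symRect]
  exact ⟨⟨by linarith [hre.1], by linarith [hre.2]⟩, by linarith [him.1], by linarith [him.2]⟩

/-- Registered stub `stub_slePreservingIsMoebius` (S4a · FAMILY-PRESERVING HOMEOMORPHISMS ARE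
MÖBIUS). A homeomorphism `T` of the plane which pushes the chordal SLE₆ law of every Dobrushin
domain `D` to the chordal SLE₆ law of the image domain `T D` is an orientation-preserving similarity
`z ↦ cz + w` or an orientation-reversing one `z ↦ c z̄ + w`. Proof: (R1) `T` preserves the
conformal modulus of every conformal rectangle (`crossRatio_eq_of_sle`); (R2, R2') hence `T` or
`conj ∘ T` is holomorphic on every square (`holoOrAnti_symRect_of_modulusPreserving`), so on `ℂ`
(the squares exhaust the plane; if `T` is holomorphic on arbitrarily large squares it is entire,
otherwise `conj ∘ T` is); (R2'') a holomorphic (resp. anti-holomorphic) homeomorphism of the plane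
is `z ↦ a z + b` (resp. `z ↦ a z̄ + b`), `Homeomorph.exists_eq_mul_add_of_differentiable`. -/
theorem stub_slePreservingIsMoebius :
    ∀ T : ℂ ≃ₜ ℂ,
      (∀ (D : DobrushinDomain) (μ : Measure (CurveClass ℂ)), IsSLELaw 6 D μ →
        IsSLELaw 6 (D.map T) (μ.map (CurveClass.map (T : C(ℂ, ℂ))))) →
      ∃ (c : ℂ) (hc : c ≠ 0) (w : ℂ), T = similarity c hc w ∨
        T = Complex.conjLIE.toHomeomorph.trans (similarity c hc w) := by
  intro T hT
  -- (R1) modulus preservation; (R2, R2') `T` or `conj ∘ T` is holomorphic on every square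
  have key : ∀ R : ℝ, 0 < R → DifferentiableOn ℂ T (symRect R R) ∨
      DifferentiableOn ℂ (fun z ↦ conj (T z)) (symRect R R) := fun R hR ↦
    holoOrAnti_symRect_of_modulusPreserving T
      (fun R' _ _ _ _ hφ hφ' ↦ crossRatio_eq_of_sle T hT R' hφ hφ') hR
  by_cases h : ∀ n : ℕ, ∃ m : ℕ, n ≤ m ∧ DifferentiableOn ℂ T (symRect ((m : ℝ) + 1) ((m : ℝ) + 1))
  · -- `T` is entire, hence affine
    have hd : Differentiable ℂ T := fun z ↦ by
      obtain ⟨m, hm, hdm⟩ := h ⌈‖z‖⌉₊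
      exact hdm.differentiableAt ((isOpen_symRect _ _).mem_nhds (mem_symRect_of_ceil_le z hm))
    obtain ⟨a, b, ha, hab⟩ := T.exists_eq_mul_add_of_differentiable hd
    exact ⟨a, ha, b, Or.inl (Homeomorph.ext fun z ↦ by rw [hab, similarity_apply])⟩
  · -- otherwise `conj ∘ T` is entire, hence `T z = a z̄ + b`
    push Not at h
    obtain ⟨n, hn⟩ := h
    have hd : Differentiable ℂ (fun z ↦ conj (T z)) := fun z ↦ by
      have h1 := (key ((max n ⌈‖z‖⌉₊ : ℕ) + 1) (by positivity)).resolve_left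
        (hn _ (le_max_left _ _))
      exact h1.differentiableAt
        ((isOpen_symRect _ _).mem_nhds (mem_symRect_of_ceil_le z (le_max_right _ _)))
    obtain ⟨a, b, ha, hab⟩ := T.exists_eq_mul_conj_add_of_differentiable_conj hd
    exact ⟨a, ha, b, Or.inr (Homeomorph.ext fun z ↦ by
      rw [hab, conjLIE_toHomeomorph_trans_similarity_apply])⟩

end Summit.CriticalPhenomena.CardyFormulaZ2.Theorems.CardyRotToConfR2SymmetryUpgrade.IsotropyKillsBeltrami
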